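import Summits.NavierStokesRegularity.NavierStokesRegularity.Theorems.EulerZoomLiouvillePowerGaugeEulerLiouvilleSelfSimilarProfileEquationTools

/-!
# The weak self-similar Euler profile equation of an exactly self-similar member, II: the identity
# (crux `EulerZoomLiouville.PowerGaugeEulerLiouville` = stmt-NavierStokesRegularity-19832, line `birth`, rung C1)

Route `EulerZoomLiouville` (NavierStokesRegularity).  MAIN THEOREMS:

* `weak_profile_equation` — for a distributional Euler pair `(u,p)` on the slab `(−∞,0) × ℝ³` (`ν = 0`, `f = 0`)
  that is exactly self-similar with exponent `γ` (`u(τ) = selfSimilarCollapse γ 0 V τ`,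
  `p(τ) = selfSimilarCollapsePressure γ 0 P τ`, `τ < 0`), `V, |V|², P ∈ L¹_loc`, and every test field `η`:
  `∫ ⟪V,(V·∇)η⟫ + P div η + γ⟪V,(y·∇)η⟫ + (4γ−1)⟪V,η⟫ = 0` — the distributional profile equation
  (Constantin–Ignatova–Vicol (3.3); Chae–Shvydkoy 2013 (2.1), `α = 1/γ − 1`), exactly the hypothesis `heq` of
  `ProfileEnergy.profile_local_energy_equality`;
* `profile_isWeaklyDivFree` — the profile is weakly divergence free.

Proof: the momentum identity tested with `χ(t)η((−t)^{−γ}x)` is, after the slice change of variables and Fubini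
(`…SelfSimilarProfileEquationTools`), `(∫χ'(−t)^{4γ−1})∫⟪V,η⟫ + (∫χ(−t)^{4γ−2})(γ∫⟪V,Dη y⟫ + ∫⟪V,DηV⟫ + ∫P div η) = 0`
(`tested_identity_selfSimilar`); an integration by parts in `t` and the fundamental lemma on `(−2,−1/2)` remove `χ`.

Context.  The crux's class members are distributional Euler pairs on the slab `(−∞,0) × ℝ³`; the lineage's
self-similar dictionary (`…SelfSimilarLEI/Gauges/Pressure/Gradient/Transfer`) transfers the local energy
INEQUALITY and the three gauges to the profile, but not the Euler identity itself.  This pair of files transfers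
the MOMENTUM IDENTITY: an exactly self-similar member `u(t) = selfSimilarCollapse γ 0 V t`,
`p(t) = selfSimilarCollapsePressure γ 0 P t` has a profile solving the self-similar Euler profile equation
`(1−γ)V + γ(y·∇)V + (V·∇)V + ∇P = 0` in the sense of distributions, and `V` is weakly divergence free — the
inputs of the profile local energy EQUALITY `ProfileEnergy.profile_local_energy_equality` (critic-2 K3: the
residue of the crux needs a lever that uses the Euler identity).  WHAT THIS IS NOT: not NS regularity, not the
crux; a C1 dictionary entry `--supports` stmt-19832. [folklore]
-/

noncomputable section

set_option linter.dupNamespace false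

open MeasureTheory Set Filter Topology Metric Function TopologicalSpace
open scoped ENNReal NNReal RealInnerProductSpace ContDiff

namespace Summit.NavierStokesRegularity.NavierStokesRegularity.Theorems.PowerGaugeEulerLiouville

open Literature.Analysis Literature.Analysis.FunctionSpaces Literature.Analysis.FluidPDE

namespace ProfileEquation

section Main
/-- **The tested identity for an exactly self-similar pair.**  For `(u, p)` a distributional Euler pair
on the slab `(−∞,0) × ℝ³` that is exactly self-similar with profile `(V, P)`, a test field `η`, and
`χ ∈ C_c^∞((a,b))`, `b < 0` (all four profile integrands integrable):
`(∫χ'(−t)^{4γ−1}) ∫⟪V,η⟫ + (∫χ(−t)^{4γ−2}) (γ∫⟪V,Dη y⟫ + ∫⟪V,Dη V⟫ + ∫P div η) = 0` — the momentum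
identity tested with `χ(t)η((−t)^{−γ}x)`, after the change of variables `x = (−t)^γ y` and Fubini.
[folklore] -/
theorem tested_identity_selfSimilar {γ : ℝ}
    {u : ℝ → EuclideanSpace ℝ (Fin 3) → EuclideanSpace ℝ (Fin 3)} {p : ℝ → EuclideanSpace ℝ (Fin 3) → ℝ}
    (hsol : IsDistributionalNSSolutionOn (slab (EuclideanSpace ℝ (Fin 3)) (Iio 0) isOpen_Iio) 0 0 u p)
    {V : EuclideanSpace ℝ (Fin 3) → EuclideanSpace ℝ (Fin 3)} {P : EuclideanSpace ℝ (Fin 3) → ℝ}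
    (hu : ∀ τ : ℝ, τ < 0 → u τ = selfSimilarCollapse γ 0 V τ)
    (hp : ∀ τ : ℝ, τ < 0 → p τ = selfSimilarCollapsePressure γ 0 P τ)
    {η : EuclideanSpace ℝ (Fin 3) → EuclideanSpace ℝ (Fin 3)}
    (hη : IsTestFunctionOn (⊤ : Opens (EuclideanSpace ℝ (Fin 3))) η)
    (hI0 : Integrable (fun y => ⟪V y, η y⟫) volume)
    (hI1 : Integrable (fun y => ⟪V y, fderiv ℝ η y y⟫) volume)
    (hI2 : Integrable (fun y => ⟪V y, fderiv ℝ η y (V y)⟫) volume)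
    (hI3 : Integrable (fun y => P y * VectorCalculus.divergence η y) volume)
    {a b : ℝ} (hb : b < 0) {χ : ℝ → ℝ} (hχ : ContDiff ℝ (⊤ : ℕ∞) χ)
    (hχI : tsupport χ ⊆ Ioo a b) :
    (∫ t, deriv χ t * (-t) ^ (4 * γ - 1)) * (∫ y, ⟪V y, η y⟫) +
      (∫ t, χ t * (-t) ^ (4 * γ - 2)) *
        (γ * (∫ y, ⟪V y, fderiv ℝ η y y⟫) +
          ((∫ y, ⟪V y, fderiv ℝ η y (V y)⟫) + ∫ y, P y * VectorCalculus.divergence η y)) = 0 := by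
  have hχd : Differentiable ℝ χ := hχ.differentiable (by simp)
  have hχ'c : Continuous (deriv χ) := hχ.continuous_deriv (by simp)
  have hηd : Differentiable ℝ η := hη.contDiff.differentiable (by simp)
  have hχ0 : ∀ t, b ≤ t → χ t = 0 := fun t ht =>
    image_eq_zero_of_notMem_tsupport fun h => (not_lt.2 ht) (hχI h).2
  have hχ'0 : ∀ t, t ∉ tsupport χ → deriv χ t = 0 := fun t ht => by
    by_contra hne; exact ht (support_deriv_subset (mem_support.2 hne))
  have hχ'0b : ∀ t, b ≤ t → deriv χ t = 0 := fun t ht => hχ'0 t fun h => (not_lt.2 ht) (hχI h).2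
  -- ### the tested momentum identity
  have hΨ := isSpaceTimeTestOn_rescaled (γ := γ) hb hχ hχI hη
  have id0 := hsol.2.2.2.2 _ hΨ
  -- the weights and the profile integrands
  set α₀ : ℝ → ℝ := fun t => deriv χ t * (-t) ^ (γ - 1) with hα₀
  set α₁ : ℝ → ℝ := fun t => γ * (χ t * (-t) ^ (γ - 2)) with hα₁
  set α₂ : ℝ → ℝ := fun t => χ t * (-t) ^ (γ - 2) with hα₂
  set g₀ : EuclideanSpace ℝ (Fin 3) → ℝ := fun y => ⟪V y, η y⟫ with hg₀
  set g₁ : EuclideanSpace ℝ (Fin 3) → ℝ := fun y => ⟪V y, fderiv ℝ η y y⟫ with hg₁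
  set g₂ : EuclideanSpace ℝ (Fin 3) → ℝ := fun y => ⟪V y, fderiv ℝ η y (V y)⟫ with hg₂
  set g₃ : EuclideanSpace ℝ (Fin 3) → ℝ := fun y => P y * VectorCalculus.divergence η y with hg₃
  set Φ : ℝ × EuclideanSpace ℝ (Fin 3) → ℝ := fun z =>
    α₀ z.1 * g₀ ((-z.1) ^ (-γ) • z.2) + α₁ z.1 * g₁ ((-z.1) ^ (-γ) • z.2) +
      α₂ z.1 * g₂ ((-z.1) ^ (-γ) • z.2) + α₂ z.1 * g₃ ((-z.1) ^ (-γ) • z.2) with hΦ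
  -- ### pointwise identification on the slab
  have hslab : ((slab (EuclideanSpace ℝ (Fin 3)) (Iio 0) isOpen_Iio : Opens (ℝ × EuclideanSpace ℝ (Fin 3))) :
      Set (ℝ × EuclideanSpace ℝ (Fin 3))) = Iio (0 : ℝ) ×ˢ (univ : Set (EuclideanSpace ℝ (Fin 3))) :=
    coe_slab (X := EuclideanSpace ℝ (Fin 3)) (Iio 0) isOpen_Iio
  have hΦint : ∫ z in Iio (0 : ℝ) ×ˢ (univ : Set (EuclideanSpace ℝ (Fin 3))), Φ z = 0 := by
    rw [← hslab]
    refine Eq.trans (setIntegral_congr_fun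
      (slab (EuclideanSpace ℝ (Fin 3)) (Iio 0) isOpen_Iio).isOpen.measurableSet fun z hz => ?_) id0
    have ht : z.1 < 0 := by rw [hslab] at hz; exact hz.1
    rw [hu z.1 ht, hp z.1 ht]
    simp only [convect_apply, zero_mul, add_zero, Pi.zero_apply, inner_zero_left]
    rw [tested_integrand_selfSimilar hχd hηd V P ht z.2]
    simp only [hΦ, hα₀, hα₁, hα₂, hg₀, hg₁, hg₂, hg₃]
    ring
  -- ### Fubini, term by term
  have hα₀c : Continuous α₀ := continuous_mul_neg_rpow hb hχ'c hχ'0b (γ - 1)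
  have hα₂c : Continuous α₂ := continuous_mul_neg_rpow hb hχ.continuous hχ0 (γ - 2)
  have hα₁c : Continuous α₁ := continuous_const.mul hα₂c
  have hα₀s : support α₀ ⊆ Ioo a b := by
    intro t ht
    rw [mem_support] at ht
    have h : deriv χ t ≠ 0 := fun h => ht (by simp only [hα₀, h, zero_mul])
    exact hχI (support_deriv_subset (mem_support.2 h))
  have hα₂s : support α₂ ⊆ Ioo a b := by
    intro t ht
    rw [mem_support] at ht
    have h : χ t ≠ 0 := fun h => ht (by simp only [hα₂, h, zero_mul])
    exact hχI (subset_tsupport _ (mem_support.2 h))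
  have hα₁s : support α₁ ⊆ Ioo a b := by
    intro t ht
    rw [mem_support] at ht
    have h : χ t ≠ 0 := fun h => ht (by simp only [hα₁, h, zero_mul, mul_zero])
    exact hχI (subset_tsupport _ (mem_support.2 h))
  obtain ⟨i0, e0⟩ := integral_slab_mul_comp_dilation (γ := γ) hb hI0 hα₀c hα₀s
  obtain ⟨i1, e1⟩ := integral_slab_mul_comp_dilation (γ := γ) hb hI1 hα₁c hα₁s
  obtain ⟨i2, e2⟩ := integral_slab_mul_comp_dilation (γ := γ) hb hI2 hα₂c hα₂s
  obtain ⟨i3, e3⟩ := integral_slab_mul_comp_dilation (γ := γ) hb hI3 hα₂c hα₂s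
  have hsplit : ∫ z in Iio (0 : ℝ) ×ˢ (univ : Set (EuclideanSpace ℝ (Fin 3))), Φ z =
      (∫ t, α₀ t * (-t) ^ (3 * γ)) * (∫ y, g₀ y) + (∫ t, α₁ t * (-t) ^ (3 * γ)) * (∫ y, g₁ y) +
        (∫ t, α₂ t * (-t) ^ (3 * γ)) * (∫ y, g₂ y) + (∫ t, α₂ t * (-t) ^ (3 * γ)) * (∫ y, g₃ y) := by
    have i01 : Integrable (fun z : ℝ × EuclideanSpace ℝ (Fin 3) =>
        α₀ z.1 * g₀ ((-z.1) ^ (-γ) • z.2) + α₁ z.1 * g₁ ((-z.1) ^ (-γ) • z.2))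
        (volume.restrict (Iio (0 : ℝ) ×ˢ (univ : Set (EuclideanSpace ℝ (Fin 3))))) := i0.add i1
    have i012 : Integrable (fun z : ℝ × EuclideanSpace ℝ (Fin 3) =>
        α₀ z.1 * g₀ ((-z.1) ^ (-γ) • z.2) + α₁ z.1 * g₁ ((-z.1) ^ (-γ) • z.2) +
          α₂ z.1 * g₂ ((-z.1) ^ (-γ) • z.2))
        (volume.restrict (Iio (0 : ℝ) ×ˢ (univ : Set (EuclideanSpace ℝ (Fin 3))))) := i01.add i2
    simp only [hΦ]
    rw [integral_add i012 i3, integral_add i01 i2, integral_add i0 i1, e0, e1, e2, e3]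
  -- ### the time integrals
  have et0 : ∫ t, α₀ t * (-t) ^ (3 * γ) = ∫ t, deriv χ t * (-t) ^ (4 * γ - 1) := by
    refine integral_congr_ae (Eventually.of_forall fun t => ?_)
    by_cases ht : t < 0
    · simp only [hα₀]
      rw [mul_assoc, ← Real.rpow_add (neg_pos.2 ht)]; congr 2; ring
    · simp only [hα₀, hχ'0b t (hb.le.trans (not_lt.1 ht)), zero_mul]
  have et2 : ∫ t, α₂ t * (-t) ^ (3 * γ) = ∫ t, χ t * (-t) ^ (4 * γ - 2) := by
    refine integral_congr_ae (Eventually.of_forall fun t => ?_)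
    by_cases ht : t < 0
    · simp only [hα₂]
      rw [mul_assoc, ← Real.rpow_add (neg_pos.2 ht)]; congr 2; ring
    · simp only [hα₂, hχ0 t (hb.le.trans (not_lt.1 ht)), zero_mul]
  have et1 : ∫ t, α₁ t * (-t) ^ (3 * γ) = γ * ∫ t, χ t * (-t) ^ (4 * γ - 2) := by
    rw [← et2, ← integral_const_mul]
    refine integral_congr_ae (Eventually.of_forall fun t => ?_)
    simp only [hα₁, hα₂]; ring
  rw [hsplit, et0, et1, et2] at hΦint
  simp only [hg₀, hg₁, hg₂, hg₃] at hΦint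
  linear_combination hΦint

/-- **THE WEAK SELF-SIMILAR EULER PROFILE EQUATION of an exactly self-similar member.**  Let `(u, p)`
solve the Euler equations in the sense of distributions on the slab `(−∞,0) × ℝ³` (`ν = 0`, `f = 0`;
tree `IsDistributionalNSSolutionOn`) and be EXACTLY SELF-SIMILAR with exponent `γ`:
`u(τ) = selfSimilarCollapse γ 0 V τ`, `p(τ) = selfSimilarCollapsePressure γ 0 P τ` for `τ < 0`, with a
locally integrable profile `V`, `|V|² ∈ L¹_loc`, `P ∈ L¹_loc`.  Then for every test field `η ∈ C_c^∞(ℝ³;ℝ³)`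

  `∫ ⟪V, (V·∇)η⟫ + P div η + γ ⟪V, (y·∇)η⟫ + (4γ − 1)⟪V, η⟫ = 0`,

the distributional form of the profile equation `(1−γ)V + γ(y·∇)V + (V·∇)V + ∇P = 0`
(Constantin–Ignatova–Vicol (3.3); Chae–Shvydkoy 2013 (2.1) with `α = 1/γ − 1`).  Proof: test the
momentum identity with the rescaled field `χ(t) η((−t)^{−γ}x)`, change variables `x = (−t)^γ y` on
each slice, and integrate by parts in `t`; the identity then reads
`(∫χ(−t)^{4γ−2}) · [(4γ−1)∫⟪V,η⟫ + γ∫⟪V,Dη y⟫ + ∫⟪V,Dη V⟫ + ∫P div η] = 0` for every `χ ∈ C_c^∞((−2,−1/2))`,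
and the fundamental lemma of the calculus of variations removes `χ`. [folklore; cf. ChaeShvydkoy2013 §2.1 eq. (2.1)] -/
theorem weak_profile_equation {γ : ℝ}
    {u : ℝ → EuclideanSpace ℝ (Fin 3) → EuclideanSpace ℝ (Fin 3)} {p : ℝ → EuclideanSpace ℝ (Fin 3) → ℝ}
    (hsol : IsDistributionalNSSolutionOn (slab (EuclideanSpace ℝ (Fin 3)) (Iio 0) isOpen_Iio) 0 0 u p)
    {V : EuclideanSpace ℝ (Fin 3) → EuclideanSpace ℝ (Fin 3)} {P : EuclideanSpace ℝ (Fin 3) → ℝ}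
    (hu : ∀ τ : ℝ, τ < 0 → u τ = selfSimilarCollapse γ 0 V τ)
    (hp : ∀ τ : ℝ, τ < 0 → p τ = selfSimilarCollapsePressure γ 0 P τ)
    (hV : LocallyIntegrable V volume) (hV2 : LocallyIntegrable (fun y => ‖V y‖ ^ 2) volume)
    (hP : LocallyIntegrable P volume)
    {η : EuclideanSpace ℝ (Fin 3) → EuclideanSpace ℝ (Fin 3)}
    (hη : IsTestFunctionOn (⊤ : Opens (EuclideanSpace ℝ (Fin 3))) η) :
    ∫ y, (⟪V y, fderiv ℝ η y (V y)⟫ + P y * VectorCalculus.divergence η y +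
      γ * ⟪V y, fderiv ℝ η y y⟫ + (4 * γ - 1) * ⟪V y, η y⟫) = 0 := by
  -- ### the test field, bounds, supports
  obtain ⟨K₀, K₁, K₂, hK₀, hK₁, -⟩ := exists_bounds_of_isTestFunctionOn hη
  have hK₀0 : 0 ≤ K₀ := (norm_nonneg _).trans (hK₀ 0)
  have hK₁0 : 0 ≤ K₁ := (norm_nonneg _).trans (hK₁ 0)
  have hηd : Differentiable ℝ η := hη.contDiff.differentiable (by simp)
  have hηc : Continuous η := hη.contDiff.continuous
  have hDηc : Continuous (fderiv ℝ η) := hη.contDiff.continuous_fderiv (by simp)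
  have hdivc : Continuous (VectorCalculus.divergence η) := continuous_divergence hDηc
  set Kη : Set (EuclideanSpace ℝ (Fin 3)) := tsupport η with hKηdef
  have hKηc : IsCompact Kη := hη.hasCompactSupport
  have hKηm : MeasurableSet Kη := hKηc.measurableSet
  obtain ⟨Rη₀, hRη₀⟩ := hKηc.isBounded.subset_closedBall (0 : EuclideanSpace ℝ (Fin 3))
  set Rη : ℝ := max Rη₀ 0 with hRηdef
  have hRη0 : 0 ≤ Rη := le_max_right _ _
  have hyR : ∀ y ∈ Kη, ‖y‖ ≤ Rη := fun y hy => by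
    have := hRη₀ hy; rw [mem_closedBall, dist_zero_right] at this; exact this.trans (le_max_left _ _)
  have hη0 : ∀ y, y ∉ Kη → η y = 0 := fun y hy => image_eq_zero_of_notMem_tsupport hy
  have hDη0 : ∀ y, y ∉ Kη → fderiv ℝ η y = 0 := fun y hy => fderiv_of_notMem_tsupport ℝ hy
  have hdiv0 : ∀ y, y ∉ Kη → VectorCalculus.divergence η y = 0 := fun y hy => by
    simp [VectorCalculus.divergence, hDη0 y hy]
  have hdivb : ∀ y, |VectorCalculus.divergence η y| ≤ 3 * K₁ := fun y => by
    have := norm_divergence_le_three_mul hK₁ y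
    rwa [Real.norm_eq_abs] at this
  have hVm : AEStronglyMeasurable V volume := hV.aestronglyMeasurable
  have hPm : AEStronglyMeasurable P volume := hP.aestronglyMeasurable
  have hin : ∀ a b : EuclideanSpace ℝ (Fin 3), |⟪a, b⟫| ≤ ‖a‖ * ‖b‖ := fun a b => abs_real_inner_le_norm a b
  -- ### integrability of the four profile integrands
  have hVK : IntegrableOn (fun y => ‖V y‖) Kη volume := (hV.integrableOn_isCompact hKηc).norm
  have hV2K : IntegrableOn (fun y => ‖V y‖ ^ 2) Kη volume := hV2.integrableOn_isCompact hKηc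
  have hPK : IntegrableOn (fun y => |P y|) Kη volume := (hP.integrableOn_isCompact hKηc).abs
  have hI0 : Integrable (fun y => ⟪V y, η y⟫) volume := by
    refine ProfileEnergy.integrable_of_abs_le_on hKηm (hVm.inner hηc.aestronglyMeasurable) hVK (C := K₀)
      (fun y _ => ?_) (fun y hy => by rw [hη0 y hy, inner_zero_right])
    rw [abs_of_nonneg (norm_nonneg _)]
    exact (hin _ _).trans (by rw [mul_comm]; exact mul_le_mul_of_nonneg_right (hK₀ y) (norm_nonneg _))
  have hI1 : Integrable (fun y => ⟪V y, fderiv ℝ η y y⟫) volume := by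
    refine ProfileEnergy.integrable_of_abs_le_on hKηm
      (hVm.inner ((hDηc.clm_apply continuous_id).aestronglyMeasurable)) hVK (C := K₁ * Rη)
      (fun y hy => ?_) (fun y hy => by rw [hDη0 y hy]; simp)
    rw [abs_of_nonneg (norm_nonneg _)]
    calc |⟪V y, fderiv ℝ η y y⟫| ≤ ‖V y‖ * ‖fderiv ℝ η y y‖ := hin _ _
      _ ≤ ‖V y‖ * (K₁ * Rη) := by
          refine mul_le_mul_of_nonneg_left ?_ (norm_nonneg _)
          exact ((fderiv ℝ η y).le_opNorm y).trans (mul_le_mul (hK₁ y) (hyR y hy) (norm_nonneg _) hK₁0)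
      _ = K₁ * Rη * ‖V y‖ := by ring
  have hI2 : Integrable (fun y => ⟪V y, fderiv ℝ η y (V y)⟫) volume := by
    refine ProfileEnergy.integrable_of_abs_le_on hKηm
      (hVm.inner (ProfileEnergy.aestronglyMeasurable_clm_apply hDηc.aestronglyMeasurable hVm)) hV2K (C := K₁)
      (fun y _ => ?_) (fun y hy => by rw [hDη0 y hy]; simp)
    rw [abs_pow, abs_norm]
    calc |⟪V y, fderiv ℝ η y (V y)⟫| ≤ ‖V y‖ * ‖fderiv ℝ η y (V y)‖ := hin _ _
      _ ≤ ‖V y‖ * (K₁ * ‖V y‖) := by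
          refine mul_le_mul_of_nonneg_left ?_ (norm_nonneg _)
          exact ((fderiv ℝ η y).le_opNorm _).trans (mul_le_mul_of_nonneg_right (hK₁ y) (norm_nonneg _))
      _ = K₁ * ‖V y‖ ^ 2 := by ring
  have hI3 : Integrable (fun y => P y * VectorCalculus.divergence η y) volume := by
    refine ProfileEnergy.integrable_of_abs_le_on hKηm (hPm.mul hdivc.aestronglyMeasurable) hPK (C := 3 * K₁)
      (fun y _ => ?_) (fun y hy => by rw [hdiv0 y hy, mul_zero])
    rw [abs_mul, abs_abs, mul_comm (3 * K₁)]
    exact mul_le_mul_of_nonneg_left (hdivb y) (abs_nonneg _)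
  -- the four integrals
  set I₀ : ℝ := ∫ y, ⟪V y, η y⟫ with hI₀
  set I₁ : ℝ := ∫ y, ⟪V y, fderiv ℝ η y y⟫ with hI₁
  set I₂ : ℝ := ∫ y, ⟪V y, fderiv ℝ η y (V y)⟫ with hI₂
  set I₃ : ℝ := ∫ y, P y * VectorCalculus.divergence η y with hI₃
  set J : ℝ := I₂ + I₃ + γ * I₁ + (4 * γ - 1) * I₀ with hJ
  have hgoal : ∫ y, (⟪V y, fderiv ℝ η y (V y)⟫ + P y * VectorCalculus.divergence η y +
      γ * ⟪V y, fderiv ℝ η y y⟫ + (4 * γ - 1) * ⟪V y, η y⟫) = J := by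
    rw [integral_add, integral_add, integral_add hI2 hI3, integral_const_mul, integral_const_mul]
    · exact hI2.add hI3
    · exact hI1.const_mul _
    · exact (hI2.add hI3).add (hI1.const_mul _)
    · exact hI0.const_mul _
  rw [hgoal]
  -- ### the key identity: for every `χ ∈ C_c^∞((−2,−1/2))`, `(∫ χ (−t)^{4γ−2}) · J = 0`
  have key : ∀ χ : ℝ → ℝ, ContDiff ℝ (⊤ : ℕ∞) χ → HasCompactSupport χ →
      tsupport χ ⊆ Ioo (-2 : ℝ) (-1 / 2) → (∫ t, χ t * (-t) ^ (4 * γ - 2)) * J = 0 := by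
    intro χ hχ hχc hχI
    have h := tested_identity_selfSimilar hsol hu hp hη hI0 hI1 hI2 hI3 (by norm_num) hχ hχI
    rw [integral_deriv_mul_neg_rpow (by norm_num : (-1 / 2 : ℝ) < 0) hχ hχc hχI (4 * γ - 1),
      show (4 * γ - 1 - 1 : ℝ) = 4 * γ - 2 by ring] at h
    simp only [hJ, hI₀, hI₁, hI₂, hI₃]
    linear_combination h
  -- ### removing `χ`
  by_contra hJne
  have hzero : ∀ χ : ℝ → ℝ, ContDiff ℝ (⊤ : ℕ∞) χ → HasCompactSupport χ →
      tsupport χ ⊆ Ioo (-2 : ℝ) (-1 / 2) → ∫ t, χ t • (fun s : ℝ => (-s) ^ (4 * γ - 2)) t = 0 := by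
    intro χ hχ hχc hχI
    have h := key χ hχ hχc hχI
    simp only [smul_eq_mul]
    rcases mul_eq_zero.1 h with h | h
    · exact h
    · exact absurd h hJne
  have hloc : LocallyIntegrableOn (fun s : ℝ => (-s) ^ (4 * γ - 2)) (Ioo (-2 : ℝ) (-1 / 2)) volume := by
    refine ContinuousOn.locallyIntegrableOn (fun t ht => ?_) measurableSet_Ioo
    exact ((contDiffAt_neg_rpow (by linarith [ht.2]) (4 * γ - 2) (n := 0)).continuousAt).continuousWithinAt
  have hae := IsOpen.ae_eq_zero_of_integral_contDiff_smul_eq_zero isOpen_Ioo hloc hzero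
  -- but `(−t)^{4γ−2} > 0` on `(−2,−1/2)`, a set of positive measure
  have hpos : ∀ t ∈ Ioo (-2 : ℝ) (-1 / 2), (fun s : ℝ => (-s) ^ (4 * γ - 2)) t ≠ 0 := fun t ht =>
    (Real.rpow_pos_of_pos (by linarith [ht.2]) _).ne'
  have hnull : volume (Ioo (-2 : ℝ) (-1 / 2)) = 0 := by
    refine measure_eq_zero_iff_ae_notMem.2 ?_
    filter_upwards [hae] with t ht hmem
    exact hpos t hmem (ht hmem)
  rw [Real.volume_Ioo] at hnull
  have : ENNReal.ofReal (-1 / 2 - (-2 : ℝ)) ≠ 0 := by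
    rw [ENNReal.ofReal_ne_zero_iff]; norm_num
  exact this hnull

/-! ## The profile is weakly divergence free -/

/-- **The profile of an exactly self-similar distributional Euler pair is weakly divergence free.**
Test the slab divergence-free identity `∫∫⟪u, ∇θ⟫ = 0` with `θ(t,x) = χ(t) ϑ((−t)^{−γ}x)`: after the change
of variables this is `(∫χ(−t)^{3γ−1}) ∫⟪V, ∇ϑ⟫ = 0` for every `χ ∈ C_c^∞((−2,−1/2))`. [folklore] -/
theorem profile_isWeaklyDivFree {γ : ℝ}
    {u : ℝ → EuclideanSpace ℝ (Fin 3) → EuclideanSpace ℝ (Fin 3)} {p : ℝ → EuclideanSpace ℝ (Fin 3) → ℝ}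
    (hsol : IsDistributionalNSSolutionOn (slab (EuclideanSpace ℝ (Fin 3)) (Iio 0) isOpen_Iio) 0 0 u p)
    {V : EuclideanSpace ℝ (Fin 3) → EuclideanSpace ℝ (Fin 3)}
    (hu : ∀ τ : ℝ, τ < 0 → u τ = selfSimilarCollapse γ 0 V τ) (hV : LocallyIntegrable V volume) :
    IsWeaklyDivFree V := by
  intro ϑ hϑ
  have hϑd : Differentiable ℝ ϑ := hϑ.contDiff.differentiable (by simp)
  have hϑc : Continuous ϑ := hϑ.contDiff.continuous
  have hDϑc : Continuous (fderiv ℝ ϑ) := hϑ.contDiff.continuous_fderiv (by simp)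
  set Kϑ : Set (EuclideanSpace ℝ (Fin 3)) := tsupport ϑ with hKϑ
  have hKϑc : IsCompact Kϑ := hϑ.hasCompactSupport
  obtain ⟨C₁, hC₁⟩ := hDϑc.bounded_above_of_compact_support (hϑ.hasCompactSupport.fderiv (𝕜 := ℝ))
  have hDϑ0 : ∀ y, y ∉ Kϑ → fderiv ℝ ϑ y = 0 := fun y hy => fderiv_of_notMem_tsupport ℝ hy
  -- the integrand `g = ⟪V, ∇ϑ⟫ = Dϑ(V)` is integrable
  set g : EuclideanSpace ℝ (Fin 3) → ℝ := fun y => ⟪V y, gradient ϑ y⟫ with hg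
  have hgeq : ∀ y, g y = fderiv ℝ ϑ y (V y) := fun y => inner_gradient_eq_fderiv_apply y (V y)
  have hVm : AEStronglyMeasurable V volume := hV.aestronglyMeasurable
  have hgi : Integrable g volume := by
    have e : g = fun y => fderiv ℝ ϑ y (V y) := funext hgeq
    rw [e]
    refine ProfileEnergy.integrable_of_abs_le_on hKϑc.measurableSet
      (ProfileEnergy.aestronglyMeasurable_clm_apply hDϑc.aestronglyMeasurable hVm)
      (hV.integrableOn_isCompact hKϑc).norm (C := C₁) (fun y _ => ?_) (fun y hy => by rw [hDϑ0 y hy]; simp)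
    rw [abs_of_nonneg (norm_nonneg _)]
    exact (Real.norm_eq_abs _ ▸ (fderiv ℝ ϑ y).le_opNorm (V y)).trans
      (mul_le_mul_of_nonneg_right (hC₁ y) (norm_nonneg _))
  -- the key identity for every `χ`
  have key : ∀ χ : ℝ → ℝ, ContDiff ℝ (⊤ : ℕ∞) χ → HasCompactSupport χ →
      tsupport χ ⊆ Ioo (-2 : ℝ) (-1 / 2) → (∫ t, χ t * (-t) ^ (3 * γ - 1)) * (∫ y, g y) = 0 := by
    intro χ hχ _ hχI
    have hb : (-1 / 2 : ℝ) < 0 := by norm_num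
    have hχ0 : ∀ t, (-1 / 2 : ℝ) ≤ t → χ t = 0 := fun t ht =>
      image_eq_zero_of_notMem_tsupport fun h => (not_lt.2 ht) (hχI h).2
    have hΘ := isSpaceTimeTestOn_rescaled (γ := γ) hb hχ hχI hϑ
    have id0 := hsol.2.2.2.1 _ hΘ
    set α : ℝ → ℝ := fun t => χ t * (-t) ^ (-1 : ℝ) with hα
    have hαc : Continuous α := continuous_mul_neg_rpow hb hχ.continuous hχ0 (-1)
    have hαs : support α ⊆ Ioo (-2 : ℝ) (-1 / 2) := by
      intro t ht
      rw [mem_support] at ht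
      have h : χ t ≠ 0 := fun h => ht (by simp only [hα, h, zero_mul])
      exact hχI (subset_tsupport _ (mem_support.2 h))
    obtain ⟨-, e0⟩ := integral_slab_mul_comp_dilation (γ := γ) hb hgi hαc hαs
    have hslab : ((slab (EuclideanSpace ℝ (Fin 3)) (Iio 0) isOpen_Iio : Opens (ℝ × EuclideanSpace ℝ (Fin 3))) :
        Set (ℝ × EuclideanSpace ℝ (Fin 3))) = Iio (0 : ℝ) ×ˢ (univ : Set (EuclideanSpace ℝ (Fin 3))) :=
      coe_slab (X := EuclideanSpace ℝ (Fin 3)) (Iio 0) isOpen_Iio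
    have h1 : ∫ z in Iio (0 : ℝ) ×ˢ (univ : Set (EuclideanSpace ℝ (Fin 3))),
        α z.1 * g ((-z.1) ^ (-γ) • z.2) = 0 := by
      rw [← hslab]
      refine Eq.trans (setIntegral_congr_fun
        (slab (EuclideanSpace ℝ (Fin 3)) (Iio 0) isOpen_Iio).isOpen.measurableSet fun z hz => ?_) id0
      have ht : z.1 < 0 := by rw [hslab] at hz; exact hz.1
      have hs : 0 < -z.1 := neg_pos.2 ht
      rw [hu z.1 ht, inner_gradient_eq_fderiv_apply, fderiv_rescaled_slice χ hϑd, selfSimilarCollapse_apply,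
        zero_sub, hgeq]
      simp only [hα, map_smul, smul_eq_mul]
      have e : (-z.1) ^ (-γ) * (-z.1) ^ (γ - 1) = (-z.1) ^ (-1 : ℝ) := by
        rw [← Real.rpow_add hs]; congr 1; ring
      linear_combination (-(χ z.1 * fderiv ℝ ϑ ((-z.1) ^ (-γ) • z.2) (V ((-z.1) ^ (-γ) • z.2)))) * e
    have et : ∫ t, α t * (-t) ^ (3 * γ) = ∫ t, χ t * (-t) ^ (3 * γ - 1) := by
      refine integral_congr_ae (Eventually.of_forall fun t => ?_)
      by_cases ht : t < 0
      · simp only [hα]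
        rw [mul_assoc, ← Real.rpow_add (neg_pos.2 ht)]; congr 2; ring
      · simp only [hα, hχ0 t (hb.le.trans (not_lt.1 ht)), zero_mul]
    rw [e0, et] at h1
    exact h1
  -- removing `χ`
  by_contra hne
  have hzero : ∀ χ : ℝ → ℝ, ContDiff ℝ (⊤ : ℕ∞) χ → HasCompactSupport χ →
      tsupport χ ⊆ Ioo (-2 : ℝ) (-1 / 2) → ∫ t, χ t • (fun s : ℝ => (-s) ^ (3 * γ - 1)) t = 0 := by
    intro χ hχ hχc hχI
    have h := key χ hχ hχc hχI
    simp only [smul_eq_mul]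
    rcases mul_eq_zero.1 h with h | h
    · exact h
    · exact absurd h hne
  have hloc : LocallyIntegrableOn (fun s : ℝ => (-s) ^ (3 * γ - 1)) (Ioo (-2 : ℝ) (-1 / 2)) volume := by
    refine ContinuousOn.locallyIntegrableOn (fun t ht => ?_) measurableSet_Ioo
    exact ((contDiffAt_neg_rpow (by linarith [ht.2]) (3 * γ - 1) (n := 0)).continuousAt).continuousWithinAt
  have hae := IsOpen.ae_eq_zero_of_integral_contDiff_smul_eq_zero isOpen_Ioo hloc hzero
  have hpos : ∀ t ∈ Ioo (-2 : ℝ) (-1 / 2), (fun s : ℝ => (-s) ^ (3 * γ - 1)) t ≠ 0 := fun t ht =>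
    (Real.rpow_pos_of_pos (by linarith [ht.2]) _).ne'
  have hnull : volume (Ioo (-2 : ℝ) (-1 / 2)) = 0 := by
    refine measure_eq_zero_iff_ae_notMem.2 ?_
    filter_upwards [hae] with t ht hmem
    exact hpos t hmem (ht hmem)
  rw [Real.volume_Ioo] at hnull
  have : ENNReal.ofReal (-1 / 2 - (-2 : ℝ)) ≠ 0 := by
    rw [ENNReal.ofReal_ne_zero_iff]; norm_num
  exact this hnull

end Main
end ProfileEquation

end Summit.NavierStokesRegularity.NavierStokesRegularity.Theorems.PowerGaugeEulerLiouville
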